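import Summits.RiemannHypothesis.RiemannHypothesis.Theorems.SoloInformedGroundStateWindowFn
import Summits.RiemannHypothesis.RiemannHypothesis.Theorems.SoloInformedGroundStateSeed
import Literature.NumberTheory.LFunctions.WeilExplicitContinuous
import Literature.NumberTheory.LFunctions.WeilArchimedeanMoments
import Literature.NumberTheory.LFunctions.WeilLineZerosDensity
import Literature.NumberTheory.LFunctions.WeilMellinBounds

/-!
# Ground-state endgame, X: unconditional superpolynomial thinness of the Weil ground state

Solo programme `solo-RiemannHypothesis-informed`, session 2, claim C17. THE THEOREM
(`weilGroundEnergy_superpoly`): for every `N`,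

  `ε(a) = inf { Re W(g ⋆ g̃) : g smooth, supp g ⊆ [-a, a], ‖g‖₂ = 1 } ≤ C_N e^{-N a}`  (`a ≥ 1`),

UNCONDITIONALLY. (Under RH `ε(a) ≥ 0`; Connes' heuristic law is `ε(a) ≈ e^{-a²/…}`; part IV of
the thermometer showed `RH ⇔ ε bounded below`; here the infimum is shown to be at any rate
superpolynomially thin from above, with no hypothesis.)

The witness is the MOLLIFIED WINDOW TEST `k_λ = g_λ ⋆ m` (`g_λ` the window test of part IX built on
the explicit seed of part VIII, `m` a fixed mollifier, `a = log(λ+1) + 1`):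
* zero side: `k̂_λ(ρ) = ĝ_λ(ρ) m̂(ρ)` with `|ĝ_λ(ρ)| ≤ C_α λ^{1-α}` at EVERY zero (E-map
  orthogonality + Poisson) and `|m̂(ρ)| ≤ D/(1+γ²)`, so by the explicit formula
  `Re W(k_λ ⋆ k̃_λ) ≤ C λ^{2(1-α)}`;
* norm side: `‖k_λ‖₂² ≥ |k̂_λ(2)|² e^{-3a}/(2a)` and `|k̂_λ(2)| ≥ c λ²`, which exactly pays for the
  `a e^{3a} ≲ λ⁴` — leaving `ε(a) ≤ C λ^{2(1-α)} = O(e^{-2(α-1)a})` for every `α`.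
-/

noncomputable section

open Complex Filter Set Topology MeasureTheory
open Literature.NumberTheory.LFunctions Literature.NumberTheory.LFunctions.WeilContinuous

namespace Summit.RiemannHypothesis.RiemannHypothesis.Theorems

/-! ## The fixed mollifier: size at `s = 2`, positivity in `L²` -/

/-- `|m̂(2)| ≥ e^{-3/2}`: `m ≥ 0` has mass one and lives on `[-1, 1]`. -/
theorem norm_weilMellin_moll_zero_two_ge : Real.exp (-(3 / 2 : ℝ)) ≤ ‖weilMellin (moll 0) 2‖ := by
  set n : ℝ → ℝ := fun t => (bump 0).normed volume t with hn
  have hn0 : ∀ t, 0 ≤ n t := fun t => (bump 0).nonneg_normed t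
  have hnc : Continuous n := (bump 0).continuous_normed
  have hns : HasCompactSupport n := (bump 0).hasCompactSupport_normed
  have hsupp : ∀ t, n t ≠ 0 → -1 < t := by
    intro t ht
    have hmem : t ∈ Function.support ((bump 0).normed volume) := ht
    rw [ContDiffBump.support_normed_eq, bump_rOut] at hmem
    have : |t| < 1 := by simpa [Real.dist_eq] using hmem
    linarith [neg_abs_le t]
  have hI : Integrable (fun t : ℝ => moll 0 t * cexp ((2 - 1 / 2) * t)) volume :=
    integrable_weilIntegrand (continuous_moll 0) (hasCompactSupport_moll 0) 2
  have hre : (weilMellin (moll 0) 2).re = ∫ t : ℝ, n t * Real.exp (3 / 2 * t) := by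
    unfold weilMellin
    have h1 := Complex.reCLM.integral_comp_comm hI
    simp only [Complex.reCLM_apply] at h1
    rw [← h1]
    refine integral_congr_ae (Eventually.of_forall fun t => ?_)
    have e1 : (2 - 1 / 2 : ℂ) * (t : ℂ) = (((3 / 2 : ℝ) * t : ℝ) : ℂ) := by push_cast; ring
    simp only [WeilContinuous.moll]
    rw [e1, ← Complex.ofReal_exp, ← Complex.ofReal_mul, Complex.ofReal_re]
  have hmono : ∫ t : ℝ, n t * Real.exp (-(3 / 2 : ℝ)) ≤ ∫ t : ℝ, n t * Real.exp (3 / 2 * t) := by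
    refine integral_mono ((hnc.integrable_of_hasCompactSupport hns).mul_const _)
      ((hnc.mul (Real.continuous_exp.comp (continuous_const.mul continuous_id))).integrable_of_hasCompactSupport
        hns.mul_right) fun t => ?_
    simp only
    by_cases ht : n t = 0
    · rw [ht, zero_mul, zero_mul]
    · exact mul_le_mul_of_nonneg_left (Real.exp_le_exp.2 (by linarith [hsupp t ht])) (hn0 t)
  have hmass : ∫ t : ℝ, n t * Real.exp (-(3 / 2 : ℝ)) = Real.exp (-(3 / 2 : ℝ)) := by
    rw [integral_mul_const, hn, (bump 0).integral_normed, one_mul]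
  calc Real.exp (-(3 / 2 : ℝ)) = ∫ t : ℝ, n t * Real.exp (-(3 / 2 : ℝ)) := hmass.symm
    _ ≤ (weilMellin (moll 0) 2).re := by rw [hre]; exact hmono
    _ ≤ ‖weilMellin (moll 0) 2‖ := Complex.re_le_norm _

/-- `0 < ∫ |m|²`. -/
theorem integral_norm_sq_moll_zero_pos : 0 < ∫ t : ℝ, ‖moll 0 t‖ ^ 2 := by
  have hc : Continuous fun t : ℝ => ‖moll 0 t‖ ^ 2 := (continuous_moll 0).norm.pow 2
  have hs : HasCompactSupport fun t : ℝ => ‖moll 0 t‖ ^ 2 :=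
    (hasCompactSupport_moll 0).norm.comp_left (g := fun x : ℝ => x ^ 2) (by simp)
  have hmem : (0 : ℝ) ∈ Function.support ((bump 0).normed volume) := by
    rw [ContDiffBump.support_normed_eq]
    exact Metric.mem_ball_self (bump 0).rOut_pos
  have h0 : moll 0 0 ≠ 0 := by
    simp only [WeilContinuous.moll]
    exact Complex.ofReal_ne_zero.2 hmem
  exact hc.integral_pos_of_hasCompactSupport_nonneg_nonzero hs (fun t => by positivity)
    (pow_ne_zero 2 (norm_ne_zero_iff.2 h0))

/-- A PRIORI BOUND: `ε(a) ≤ B₀` for every `a ≥ 1` (test with the mollifier itself). -/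
theorem weilGroundEnergy_le_const :
    ∃ B : ℝ, 0 ≤ B ∧ ∀ a : ℝ, 1 ≤ a → weilGroundEnergy a ≤ B := by
  refine ⟨max 0 ((weilQuadratic (moll 0)).re / ∫ t : ℝ, ‖moll 0 t‖ ^ 2), le_max_left _ _,
    fun a ha => ?_⟩
  refine (weilGroundEnergy_le_div (isWeilTest_moll 0) ?_ integral_norm_sq_moll_zero_pos).trans
    (le_max_right _ _)
  refine closure_minimal (fun t ht => ?_) isClosed_Icc
  by_contra habs
  refine ht (moll_eq_zero ?_)
  rw [bump_rOut]
  norm_num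
  by_contra hlt
  push Not at hlt
  exact habs ⟨by linarith [neg_abs_le t, (abs_lt.1 hlt).1], by linarith [(abs_lt.1 hlt).2]⟩

/-! ## The mollified window test -/

/-- `k_λ = g_λ ⋆ m`, with `g_λ` the window test of the explicit seed. -/
def decayTest (lam : ℝ) : ℝ → ℂ := weilConv (winTest seed lam) (moll 0)

/-- `a(λ) = log(λ+1) + 1`, the support radius of `k_λ`. -/
def decayRadius (lam : ℝ) : ℝ := Real.log (lam + 1) + 1

/-- `0 < a(λ)` for `λ > 0`. -/
theorem decayRadius_pos {lam : ℝ} (hlam : 0 < lam) : 0 < decayRadius lam := by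
  unfold decayRadius
  linarith [Real.log_nonneg (by linarith : (1 : ℝ) ≤ lam + 1)]

/-- `k_λ` is a Weil test function. -/
theorem isWeilTest_decayTest {lam : ℝ} (hlam : 0 < lam) : IsWeilTest (decayTest lam) :=
  isWeilTest_weilConv_moll (continuous_winTest seed hlam)
    (hasCompactSupport_winTest seed seed_eq_zero_of_one_lt hlam) 0

/-- `k_λ` vanishes for `|x| > a(λ)`. -/
theorem decayTest_eq_zero {lam : ℝ} (hlam : 0 < lam) {x : ℝ} (hx : decayRadius lam < |x|) :
    decayTest lam x = 0 :=
  weilConv_moll_eq_zero (fun _ hu => winTest_eq_zero seed seed_eq_zero_of_one_lt hlam hu) hx 0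

/-- Support of `k_λ`. -/
theorem tsupport_decayTest {lam : ℝ} (hlam : 0 < lam) :
    tsupport (decayTest lam) ⊆ Icc (-decayRadius lam) (decayRadius lam) := by
  refine closure_minimal (fun t ht => ?_) isClosed_Icc
  by_contra habs
  refine ht (decayTest_eq_zero hlam ?_)
  by_contra hle
  push Not at hle
  exact habs ⟨by linarith [neg_abs_le t], by linarith [le_abs_self t]⟩

/-- `k̂_λ = ĝ_λ · m̂`. -/
theorem weilMellin_decayTest {lam : ℝ} (hlam : 0 < lam) (s : ℂ) :
    weilMellin (decayTest lam) s = weilMellin (winTest seed lam) s * weilMellin (moll 0) s :=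
  weilMellin_weilConv_moll (continuous_winTest seed hlam)
    (hasCompactSupport_winTest seed seed_eq_zero_of_one_lt hlam) 0 s

/-! ## Zero side: the Weil form of `k_λ` is small -/

/-- **ZERO SIDE.** For every `α > 1`: `Re W(k_λ ⋆ k̃_λ) ≤ C λ^{2(1-α)}` for `λ ≥ 1`. -/
theorem re_weilQuadratic_decayTest_le {α : ℝ} (hα : 1 < α) :
    ∃ C : ℝ, 0 ≤ C ∧ ∀ lam : ℝ, 1 ≤ lam →
      (weilQuadratic (decayTest lam)).re ≤ C * lam ^ (2 * (1 - α)) := by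
  obtain ⟨C₁, hC₁0, hC₁⟩ :=
    norm_weilMellin_winTest_le seed seed_even seed_zero integral_seed seed_eq_zero_of_one_lt hα
  set D : ℝ := weilDecayConst (moll 0) with hD
  set W : ℝ := ∑' ρ : ZetaZeros.riemannZetaNontrivialZeros, weilZeroWeight (ρ : ℂ) with hW
  have hD0 : 0 ≤ D := weilDecayConst_nonneg _
  have hW0 : 0 ≤ W := tsum_weilZeroWeight_nonneg
  refine ⟨(C₁ * D) ^ 2 * W, by positivity, fun lam hlam => ?_⟩
  have hlam0 : 0 < lam := by linarith
  set A : ℝ := (C₁ * lam ^ (1 - α) * D) ^ 2 with hA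
  have hzero : ∀ ρ ∈ ZetaZeros.riemannZetaNontrivialZeros,
      ‖weilMellin (decayTest lam) ρ‖ ^ 2 ≤ A / (1 + ρ.im ^ 2) ^ 2 := by
    intro ρ hρ
    obtain ⟨-, hre, hre1⟩ := mem_riemannZetaNontrivialZeros_iff_holds.1 hρ
    have h1 : ‖weilMellin (winTest seed lam) ρ‖ ≤ C₁ * lam ^ (1 - α) := hC₁ lam hlam ρ hρ
    have h2 : ‖weilMellin (moll 0) ρ‖ ≤ D / (1 + ρ.im ^ 2) :=
      norm_weilMellin_le (isWeilTest_moll 0) hre.le hre1.le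
    have hpos : 0 < 1 + ρ.im ^ 2 := by positivity
    have h3 : ‖weilMellin (decayTest lam) ρ‖ ≤ C₁ * lam ^ (1 - α) * D / (1 + ρ.im ^ 2) := by
      rw [weilMellin_decayTest hlam0, norm_mul, mul_div_assoc]
      exact mul_le_mul h1 h2 (norm_nonneg _) (mul_nonneg hC₁0 (Real.rpow_nonneg hlam0.le _))
    have h4 : 0 ≤ C₁ * lam ^ (1 - α) * D / (1 + ρ.im ^ 2) := by positivity
    calc ‖weilMellin (decayTest lam) ρ‖ ^ 2 ≤ (C₁ * lam ^ (1 - α) * D / (1 + ρ.im ^ 2)) ^ 2 :=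
          pow_le_pow_left₀ (norm_nonneg _) h3 2
      _ = A / (1 + ρ.im ^ 2) ^ 2 := by rw [hA, div_pow]
  have hsum := zeroSum_le_of_norm_sq_le (g := decayTest lam) (A := A) (by positivity) hzero
  have := re_weilQuadratic_le_of_zeroSum_le (isWeilTest_decayTest hlam0) hsum
  calc (weilQuadratic (decayTest lam)).re ≤ A * W := this
    _ = (C₁ * D) ^ 2 * W * lam ^ (2 * (1 - α)) := by
        rw [hA, mul_comm (2 : ℝ), Real.rpow_mul hlam0.le, Real.rpow_two]
        ring

/-! ## Norm side: `k_λ` is not small in `L²` -/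

/-- **NORM SIDE, I.** `|k̂_λ(2)| ≥ c λ²` for `λ ≥ λ₀`. -/
theorem norm_weilMellin_decayTest_two_ge :
    ∃ c lam₀ : ℝ, 0 < c ∧ 1 ≤ lam₀ ∧ ∀ lam : ℝ, lam₀ ≤ lam →
      c * lam ^ 2 ≤ ‖weilMellin (decayTest lam) 2‖ := by
  obtain ⟨C₂, hC₂⟩ :=
    norm_weilMellin_winTest_two_ge seed seed_even seed_zero integral_seed seed_eq_zero_of_one_lt
  set c₀ : ℝ := Real.pi ^ 2 / 6 * ‖mellin (fun x : ℝ => seed x) 2‖ with hc₀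
  have hc₀0 : 0 < c₀ := by
    rw [hc₀]
    exact mul_pos (by positivity) norm_mellin_seed_two_pos
  refine ⟨c₀ / 2 * Real.exp (-(3 / 2 : ℝ)), max 1 (2 * |C₂| / c₀ + 1), by positivity, le_max_left _ _,
    fun lam hlam => ?_⟩
  have hlam1 : 1 ≤ lam := (le_max_left _ _).trans hlam
  have hlam0 : 0 < lam := by linarith
  have hlamC : 2 * |C₂| / c₀ ≤ lam := by linarith [(le_max_right _ _).trans hlam]
  -- `C₂ ≤ (c₀/2) λ²`
  have hC : C₂ ≤ c₀ / 2 * lam ^ 2 := by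
    have h1 : 2 * |C₂| ≤ c₀ * lam := by
      have := (div_le_iff₀ hc₀0).1 hlamC
      linarith
    have h2 : c₀ * lam ≤ c₀ * lam ^ 2 := by
      rw [sq]
      exact mul_le_mul_of_nonneg_left (le_mul_of_one_le_left hlam0.le hlam1) hc₀0.le
    linarith [le_abs_self C₂]
  have hg : c₀ / 2 * lam ^ 2 ≤ ‖weilMellin (winTest seed lam) 2‖ := by
    have := hC₂ lam hlam1
    linarith
  rw [weilMellin_decayTest hlam0, norm_mul]
  calc c₀ / 2 * Real.exp (-(3 / 2 : ℝ)) * lam ^ 2 = c₀ / 2 * lam ^ 2 * Real.exp (-(3 / 2 : ℝ)) := by ring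
    _ ≤ ‖weilMellin (winTest seed lam) 2‖ * ‖weilMellin (moll 0) 2‖ :=
        mul_le_mul hg norm_weilMellin_moll_zero_two_ge (Real.exp_pos _).le (norm_nonneg _)

/-- **NORM SIDE, II.** `‖k_λ‖₂² ≥ |k̂_λ(2)|² e^{-3a}/(2a)`, `a = a(λ)`. -/
theorem integral_norm_sq_decayTest_ge {lam : ℝ} (hlam : 0 < lam) :
    ‖weilMellin (decayTest lam) 2‖ ^ 2 * (Real.exp (-(3 * decayRadius lam)) / (2 * decayRadius lam))
      ≤ ∫ t : ℝ, ‖decayTest lam t‖ ^ 2 := by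
  set a := decayRadius lam with ha
  have ha0 : 0 < a := decayRadius_pos hlam
  have hk : IsWeilTest (decayTest lam) := isWeilTest_decayTest hlam
  have hsupp := tsupport_decayTest hlam
  have h1 : ‖weilMellin (decayTest lam) 2‖ ≤ Real.exp (a * |(2 : ℂ).re - 1 / 2|) * ∫ t, ‖decayTest lam t‖ :=
    norm_weilMellin_le_exp_mul_integral_norm hk.1.continuous hk.2 hsupp 2
  have h32 : |(2 : ℂ).re - 1 / 2| = 3 / 2 := by norm_num
  rw [h32] at h1
  have h2 : weilNorm1 (decayTest lam) ^ 2 ≤ 2 * a * weilNorm2Sq (decayTest lam) :=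
    weilNorm1_sq_le hk ha0 hsupp
  simp only [weilNorm1, weilNorm2Sq] at h2
  have hI0 : 0 ≤ ∫ t, ‖decayTest lam t‖ := integral_nonneg fun t => norm_nonneg _
  have h3 : ‖weilMellin (decayTest lam) 2‖ ^ 2 ≤ Real.exp (3 * a) * (2 * a * ∫ t : ℝ, ‖decayTest lam t‖ ^ 2) := by
    calc ‖weilMellin (decayTest lam) 2‖ ^ 2 ≤ (Real.exp (a * (3 / 2)) * ∫ t, ‖decayTest lam t‖) ^ 2 :=
          pow_le_pow_left₀ (norm_nonneg _) h1 2
      _ = Real.exp (3 * a) * (∫ t, ‖decayTest lam t‖) ^ 2 := by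
          rw [mul_pow, ← Real.exp_nat_mul]; ring_nf
      _ ≤ Real.exp (3 * a) * (2 * a * ∫ t : ℝ, ‖decayTest lam t‖ ^ 2) :=
          mul_le_mul_of_nonneg_left h2 (Real.exp_pos _).le
  have hfac : 0 ≤ Real.exp (-(3 * a)) / (2 * a) := by positivity
  calc ‖weilMellin (decayTest lam) 2‖ ^ 2 * (Real.exp (-(3 * a)) / (2 * a))
      ≤ Real.exp (3 * a) * (2 * a * ∫ t : ℝ, ‖decayTest lam t‖ ^ 2) * (Real.exp (-(3 * a)) / (2 * a)) :=
        mul_le_mul_of_nonneg_right h3 hfac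
    _ = ∫ t : ℝ, ‖decayTest lam t‖ ^ 2 := by
        rw [Real.exp_neg]
        field_simp

/-! ## Assembly -/

/-- `a e^{3a} ≤ 32 e³ λ⁴` for `a = log(λ+1)+1`, `λ ≥ 1`. -/
theorem decayRadius_mul_exp_le {lam : ℝ} (hlam : 1 ≤ lam) :
    2 * decayRadius lam * Real.exp (3 * decayRadius lam) ≤ 32 * Real.exp 3 * lam ^ 4 := by
  have hlam0 : 0 < lam := by linarith
  have ha : decayRadius lam ≤ 2 * lam := by
    unfold decayRadius
    have := Real.log_le_sub_one_of_pos (by linarith : (0 : ℝ) < lam + 1)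
    linarith
  have ha0 : 0 < decayRadius lam := decayRadius_pos hlam0
  have hexp : Real.exp (3 * decayRadius lam) = Real.exp 3 * (lam + 1) ^ 3 := by
    unfold decayRadius
    rw [show 3 * (Real.log (lam + 1) + 1) = 3 + (3 : ℕ) * Real.log (lam + 1) by push_cast; ring,
      Real.exp_add, Real.exp_nat_mul, Real.exp_log (by linarith)]
  rw [hexp]
  have h1 : (lam + 1) ^ 3 ≤ (2 * lam) ^ 3 := pow_le_pow_left₀ (by linarith) (by linarith) 3
  calc 2 * decayRadius lam * (Real.exp 3 * (lam + 1) ^ 3)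
      ≤ 2 * (2 * lam) * (Real.exp 3 * (2 * lam) ^ 3) := by gcongr
    _ = 32 * Real.exp 3 * lam ^ 4 := by ring

/-- **MAIN ESTIMATE IN `λ`.** For every `α > 1`: `ε(a(λ)) ≤ C λ^{2(1-α)}` for `λ ≥ λ₀`. -/
theorem weilGroundEnergy_decayRadius_le {α : ℝ} (hα : 1 < α) :
    ∃ C lam₀ : ℝ, 0 ≤ C ∧ 1 ≤ lam₀ ∧ ∀ lam : ℝ, lam₀ ≤ lam →
      weilGroundEnergy (decayRadius lam) ≤ C * lam ^ (2 * (1 - α)) := by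
  obtain ⟨C, hC0, hC⟩ := re_weilQuadratic_decayTest_le hα
  obtain ⟨c, lam₀, hc, hlam₀, hcl⟩ := norm_weilMellin_decayTest_two_ge
  refine ⟨C * (32 * Real.exp 3) / c ^ 2, lam₀, by positivity, hlam₀, fun lam hlam => ?_⟩
  have hlam1 : 1 ≤ lam := hlam₀.trans hlam
  have hlam0 : 0 < lam := by linarith
  set a := decayRadius lam with ha
  have ha0 : 0 < a := decayRadius_pos hlam0
  set N2 : ℝ := ∫ t : ℝ, ‖decayTest lam t‖ ^ 2 with hN2
  -- the `L²` norm from below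
  have hk2 : c * lam ^ 2 ≤ ‖weilMellin (decayTest lam) 2‖ := hcl lam hlam
  have hlow : (c * lam ^ 2) ^ 2 * (Real.exp (-(3 * a)) / (2 * a)) ≤ N2 := by
    calc (c * lam ^ 2) ^ 2 * (Real.exp (-(3 * a)) / (2 * a))
        ≤ ‖weilMellin (decayTest lam) 2‖ ^ 2 * (Real.exp (-(3 * a)) / (2 * a)) :=
          mul_le_mul_of_nonneg_right (pow_le_pow_left₀ (by positivity) hk2 2) (by positivity)
      _ ≤ N2 := integral_norm_sq_decayTest_ge hlam0
  have hlowpos : 0 < (c * lam ^ 2) ^ 2 * (Real.exp (-(3 * a)) / (2 * a)) := by positivity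
  have hN2pos : 0 < N2 := hlowpos.trans_le hlow
  -- the Rayleigh quotient
  have hR := weilGroundEnergy_le_div (isWeilTest_decayTest hlam0) (tsupport_decayTest hlam0) hN2pos
  have hQ : (weilQuadratic (decayTest lam)).re ≤ C * lam ^ (2 * (1 - α)) := hC lam hlam1
  have hnum : 0 ≤ C * lam ^ (2 * (1 - α)) := mul_nonneg hC0 (Real.rpow_nonneg hlam0.le _)
  have hae := decayRadius_mul_exp_le hlam1
  calc weilGroundEnergy (decayRadius lam) ≤ (weilQuadratic (decayTest lam)).re / N2 := hR
    _ ≤ C * lam ^ (2 * (1 - α)) / N2 := div_le_div_of_nonneg_right hQ hN2pos.le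
    _ ≤ C * lam ^ (2 * (1 - α)) / ((c * lam ^ 2) ^ 2 * (Real.exp (-(3 * a)) / (2 * a))) :=
        div_le_div_of_nonneg_left hnum hlowpos hlow
    _ = C * lam ^ (2 * (1 - α)) * (2 * a * Real.exp (3 * a)) / (c ^ 2 * lam ^ 4) := by
        rw [Real.exp_neg]
        field_simp
    _ ≤ C * lam ^ (2 * (1 - α)) * (32 * Real.exp 3 * lam ^ 4) / (c ^ 2 * lam ^ 4) := by
        gcongr
    _ = C * (32 * Real.exp 3) / c ^ 2 * lam ^ (2 * (1 - α)) := by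
        field_simp

/-- **UNCONDITIONAL SUPERPOLYNOMIAL THINNESS OF THE WEIL GROUND STATE** (claim C17 of the solo
programme): for every `N` there is `C_N` with `ε(a) ≤ C_N e^{-N a}` for all `a ≥ 1`, where
`ε(a) = weilGroundEnergy a` is the infimum of `Re W(g ⋆ g̃)` over `L²`-normalised smooth `g`
supported in `[-a, a]`. No hypothesis on the zeros is used: the decay is certified by the mollified
E-map window tests, which are Mellin-small at every zero wherever it lies. -/
theorem weilGroundEnergy_superpoly (N : ℕ) :
    ∃ C : ℝ, ∀ a : ℝ, 1 ≤ a → weilGroundEnergy a ≤ C * Real.exp (-(N * a)) := by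
  -- exponent: `2(1-α) = -(N+1)`
  set α : ℝ := 1 + ((N : ℝ) + 1) / 2 with hαdef
  have hα : 1 < α := by rw [hαdef]; have := N.cast_nonneg (α := ℝ); linarith
  have h2α : 2 * (1 - α) = -((N : ℝ) + 1) := by rw [hαdef]; ring
  obtain ⟨C, lam₀, hC0, hlam₀, hC⟩ := weilGroundEnergy_decayRadius_le hα
  obtain ⟨B, hB0, hB⟩ := weilGroundEnergy_le_const
  -- threshold in `a`: beyond `a₁` the dilation `λ(a) = e^{a-1} - 1` is `≥ λ₀` and `≥ e^{a-1}/2`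
  set a₁ : ℝ := max 2 (Real.log (lam₀ + 1) + 1) with ha₁
  refine ⟨max (C * (2 * Real.exp 1) ^ (N + 1)) (B * Real.exp (N * a₁)), fun a ha => ?_⟩
  rcases le_or_gt a a₁ with hsmall | hlarge
  · -- small `a`: a priori bound
    calc weilGroundEnergy a ≤ B := hB a ha
      _ = B * Real.exp (N * a₁) * Real.exp (-(N * a₁)) := by
          rw [mul_assoc, ← Real.exp_add, add_neg_cancel, Real.exp_zero, mul_one]
      _ ≤ B * Real.exp (N * a₁) * Real.exp (-(N * a)) := by
          gcongr
      _ ≤ max (C * (2 * Real.exp 1) ^ (N + 1)) (B * Real.exp (N * a₁)) * Real.exp (-(N * a)) :=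
          mul_le_mul_of_nonneg_right (le_max_right _ _) (Real.exp_pos _).le
  · -- large `a`: `a = decayRadius λ` with `λ = e^{a-1} - 1`
    set lam : ℝ := Real.exp (a - 1) - 1 with hlamdef
    have ha2 : 2 ≤ a := le_trans (le_max_left _ _) hlarge.le
    have hexp2 : 2 ≤ Real.exp (a - 1) := by
      have : Real.exp 1 ≤ Real.exp (a - 1) := Real.exp_le_exp.2 (by linarith)
      linarith [Real.add_one_le_exp (1 : ℝ)]
    have hlam1 : 1 ≤ lam := by rw [hlamdef]; linarith
    have hlam0 : 0 < lam := by linarith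
    have hrad : decayRadius lam = a := by
      unfold decayRadius
      rw [hlamdef, sub_add_cancel, Real.log_exp]
      ring
    have hlamge : lam₀ ≤ lam := by
      have h1 : Real.log (lam₀ + 1) + 1 < a := lt_of_le_of_lt (le_max_right _ _) hlarge
      have h2 : Real.exp (Real.log (lam₀ + 1)) < Real.exp (a - 1) := Real.exp_lt_exp.2 (by linarith)
      rw [Real.exp_log (by linarith)] at h2
      rw [hlamdef]; linarith
    have hhalf : Real.exp (a - 1) / 2 ≤ lam := by rw [hlamdef]; linarith
    have hmain := hC lam hlamge
    rw [hrad, h2α] at hmain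
    -- `λ^{-(N+1)} ≤ (2e)^{N+1} e^{-N a}`
    have hpow : lam ^ (-((N : ℝ) + 1)) ≤ (2 * Real.exp 1) ^ (N + 1) * Real.exp (-(N * a)) := by
      rw [Real.rpow_neg hlam0.le, show ((N : ℝ) + 1) = ((N + 1 : ℕ) : ℝ) by push_cast; ring,
        Real.rpow_natCast]
      have hq : (Real.exp (a - 1) / 2) ^ (N + 1) ≤ lam ^ (N + 1) :=
        pow_le_pow_left₀ (by positivity) hhalf (N + 1)
      have hqpos : 0 < (Real.exp (a - 1) / 2) ^ (N + 1) := by positivity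
      have hinv : ((Real.exp (a - 1) / 2) ^ (N + 1))⁻¹
          = (2 * Real.exp 1) ^ (N + 1) * Real.exp (-a) ^ (N + 1) := by
        rw [← inv_pow, ← mul_pow]
        congr 1
        rw [inv_div, Real.exp_sub, Real.exp_neg]
        field_simp
      have hle : Real.exp (-a) ^ (N + 1) ≤ Real.exp (-(N * a)) := by
        rw [← Real.exp_nat_mul]
        refine Real.exp_le_exp.2 ?_
        push_cast
        nlinarith
      calc (lam ^ (N + 1))⁻¹ ≤ ((Real.exp (a - 1) / 2) ^ (N + 1))⁻¹ := inv_anti₀ hqpos hq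
        _ = (2 * Real.exp 1) ^ (N + 1) * Real.exp (-a) ^ (N + 1) := hinv
        _ ≤ (2 * Real.exp 1) ^ (N + 1) * Real.exp (-(N * a)) :=
            mul_le_mul_of_nonneg_left hle (by positivity)
    calc weilGroundEnergy a ≤ C * lam ^ (-((N : ℝ) + 1)) := hmain
      _ ≤ C * ((2 * Real.exp 1) ^ (N + 1) * Real.exp (-(N * a))) := mul_le_mul_of_nonneg_left hpow hC0
      _ = C * (2 * Real.exp 1) ^ (N + 1) * Real.exp (-(N * a)) := by ring
      _ ≤ max (C * (2 * Real.exp 1) ^ (N + 1)) (B * Real.exp (N * a₁)) * Real.exp (-(N * a)) :=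
          mul_le_mul_of_nonneg_right (le_max_left _ _) (Real.exp_pos _).le

/-- The same, against the summit's dichotomy (part IV, `weilGroundEnergy_dichotomy`): the Weil
ground state is superpolynomially thin unconditionally, and `RH` is exactly the assertion that it
is nevertheless bounded below (`riemannHypothesis_iff_weilGroundEnergy_bddBelow`). -/
theorem weilGroundEnergy_superpoly' (N : ℕ) :
    ∃ C : ℝ, ∀ a : ℝ, 1 ≤ a → Real.exp (N * a) * weilGroundEnergy a ≤ C := by
  obtain ⟨C, hC⟩ := weilGroundEnergy_superpoly N
  refine ⟨C, fun a ha => ?_⟩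
  have := mul_le_mul_of_nonneg_left (hC a ha) (Real.exp_pos (N * a)).le
  rwa [← mul_assoc, mul_comm (Real.exp _) C, mul_assoc, ← Real.exp_add, add_neg_cancel,
    Real.exp_zero, mul_one] at this

end Summit.RiemannHypothesis.RiemannHypothesis.Theorems
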